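import Summits.AtomisticToContinuum.Crystallization.Theses.ChessboardParticlePlanes

/-!
# Crux `ChessboardParticlePlanes.LjPlaneChessboard` (stmt-AtomisticToContinuum-6709), line `Sketch`,
# stub 5 `stub_sliceIdentity` — the exponential-slice mismatch identity (sum of squares)

Layers `j ∈ ℕ` carry complex amplitudes `a j`, quasi-periodic of period `n` with a unimodular
twist `ω` (`a (j + n) = ω * a j`, `‖ω‖ = 1`), sit at heights `z j` with spacings
`z (j + 1) = z j + c j`, `c j > 0` of period `n`, and interact through one exponential slice
`x ^ |Δz|`, `0 < x < 1`.  With the upward field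
`U i := ∑' k, x ^ (z (i + 1 + k) - z i) * a (i + 1 + k)` the chessboard deficit of the slice over
one period is an exact sum of squares:

`∑_{i<n} [ (2 Re(aᵢ āᵢ₊₁) x^{cᵢ} + (|aᵢ|² + |aᵢ₊₁|²) x^{2cᵢ}) / (1 − x^{2cᵢ}) − 2 Re(aᵢ Ūᵢ) ]
   = ∑_{i<n} |(1 − x^{2cᵢ}) Uᵢ₊₁ − x^{cᵢ} aᵢ − x^{2cᵢ} aᵢ₊₁|² / (1 − x^{2cᵢ})`.

Proof (pure Mathlib): the series defining `U i` is dominated by a geometric series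
(`sliceIdentity_summable`); splitting off its first term gives the Markov property
`U i = x^{cᵢ} (aᵢ₊₁ + Uᵢ₊₁)` (`sliceIdentity_markov`); quasi-periodicity gives `U n = ω U 0`, so
`‖U n‖ = ‖U 0‖` (`sliceIdentity_norm_period`); and, index by index,
`LHSᵢ − RHSᵢ = ‖Uᵢ‖² − ‖Uᵢ₊₁‖²` is a polynomial identity in the real and imaginary parts
(`sliceIdentity_alg`), which telescopes over the period (`sliceIdentity_core`).
[folklore; cf. Giuliani–Lebowitz–Lieb, block reflection positivity for 1-D exponential
interactions]
-/

noncomputable section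

namespace Summit.AtomisticToContinuum.Crystallization.Theorems.ChessboardParticlePlanesLjPlaneChessboard

/-- **Per-index algebra.**  For complex `A B W V`, real `y` with `1 - y² ≠ 0` and
`V = y (B + W)`:
`(2 Re(A B̄) y + (|A|² + |B|²) y²)/(1 − y²) − 2 Re(A V̄) − |(1 − y²) W − y A − y² B|²/(1 − y²)
  = |V|² − |W|²`. -/
theorem sliceIdentity_alg (A B W V : ℂ) (y : ℝ) (hy : 1 - y ^ 2 ≠ 0)
    (hV : V = ((y : ℝ) : ℂ) * (B + W)) :
    (2 * (A * starRingEnd ℂ B).re * y + (‖A‖ ^ 2 + ‖B‖ ^ 2) * y ^ 2) / (1 - y ^ 2)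
          - 2 * (A * starRingEnd ℂ V).re
        - ‖((1 - y ^ 2 : ℝ) : ℂ) * W - ((y : ℝ) : ℂ) * A - ((y ^ 2 : ℝ) : ℂ) * B‖ ^ 2
          / (1 - y ^ 2)
      = ‖V‖ ^ 2 - ‖W‖ ^ 2 := by
  subst hV
  simp only [Complex.sq_norm, Complex.normSq_apply, Complex.mul_re, Complex.mul_im,
    Complex.conj_re, Complex.conj_im, Complex.ofReal_re, Complex.ofReal_im, Complex.sub_re,
    Complex.sub_im, Complex.add_re, Complex.add_im]
  field_simp
  ring

/-- **Telescoping.**  If `U : ℕ → ℂ` has the Markov property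
`U i = x^{cᵢ} (aᵢ₊₁ + Uᵢ₊₁)` and `‖U n‖ = ‖U 0‖`, then the slice identity holds with `U i`,
`U (i + 1)` in place of the two series: index by index `LHSᵢ − RHSᵢ = ‖Uᵢ‖² − ‖Uᵢ₊₁‖²`
(`sliceIdentity_alg` with `y = x^{cᵢ}`, `x^{2cᵢ} = y²`), which telescopes to
`‖U 0‖² − ‖U n‖² = 0`. -/
theorem sliceIdentity_core (n : ℕ) (a : ℕ → ℂ) (c : ℕ → ℝ) (x : ℝ) (U : ℕ → ℂ)
    (hx : 0 < x) (hx1 : x < 1) (hcpos : ∀ j, 0 < c j)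
    (hU : ∀ i, U i = ((x ^ (c i) : ℝ) : ℂ) * (a (i + 1) + U (i + 1)))
    (hUn : ‖U n‖ = ‖U 0‖) :
    ∑ i ∈ Finset.range n,
        ((2 * (a i * starRingEnd ℂ (a (i + 1))).re * x ^ (c i)
            + (‖a i‖ ^ 2 + ‖a (i + 1)‖ ^ 2) * x ^ (2 * c i)) / (1 - x ^ (2 * c i))
          - 2 * (a i * starRingEnd ℂ (U i)).re)
      = ∑ i ∈ Finset.range n,
        ‖((1 - x ^ (2 * c i) : ℝ) : ℂ) * U (i + 1)
            - ((x ^ (c i) : ℝ) : ℂ) * a i - ((x ^ (2 * c i) : ℝ) : ℂ) * a (i + 1)‖ ^ 2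
          / (1 - x ^ (2 * c i)) := by
  have key : ∀ i : ℕ,
      (2 * (a i * starRingEnd ℂ (a (i + 1))).re * x ^ (c i)
            + (‖a i‖ ^ 2 + ‖a (i + 1)‖ ^ 2) * x ^ (2 * c i)) / (1 - x ^ (2 * c i))
          - 2 * (a i * starRingEnd ℂ (U i)).re
        - ‖((1 - x ^ (2 * c i) : ℝ) : ℂ) * U (i + 1)
            - ((x ^ (c i) : ℝ) : ℂ) * a i - ((x ^ (2 * c i) : ℝ) : ℂ) * a (i + 1)‖ ^ 2
          / (1 - x ^ (2 * c i))
        = ‖U i‖ ^ 2 - ‖U (i + 1)‖ ^ 2 := by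
    intro i
    have hy2 : x ^ (2 * c i) = (x ^ (c i)) ^ 2 := by
      rw [mul_comm, Real.rpow_mul hx.le, Real.rpow_two]
    have h0 : 0 ≤ x ^ (c i) := Real.rpow_nonneg hx.le _
    have h1 : x ^ (c i) < 1 := Real.rpow_lt_one hx.le hx1 (hcpos i)
    have h2 : (x ^ (c i)) ^ 2 < 1 := pow_lt_one₀ h0 h1 two_ne_zero
    have hy : 1 - (x ^ (c i)) ^ 2 ≠ 0 := sub_ne_zero.2 h2.ne'
    rw [hy2]
    exact sliceIdentity_alg (a i) (a (i + 1)) (U (i + 1)) (U i) (x ^ (c i)) hy (hU i)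
  have tel := Finset.sum_range_sub' (fun i => ‖U i‖ ^ 2) n
  simp only [hUn, sub_self] at tel
  rw [← sub_eq_zero, ← Finset.sum_sub_distrib, Finset.sum_congr rfl fun i _ => key i]
  exact tel

/-- **Summability of the upward field.**  Under the hypotheses of `stub_sliceIdentity` the
series `∑_k x^{z(i+1+k) − z(i)} a (i + 1 + k)` converges absolutely: the amplitudes are bounded
(`‖a (j + n)‖ = ‖a j‖`), the spacings are bounded below by some `c_min > 0` (finitely many values),
so the `k`-th term is at most `M (x^{c_min})^k`. -/
theorem sliceIdentity_summable (n : ℕ) (ω : ℂ) (a : ℕ → ℂ) (c z : ℕ → ℝ) (x : ℝ)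
    (hn : 0 < n) (hω : ‖ω‖ = 1) (hx : 0 < x) (hx1 : x < 1)
    (ha : ∀ j, a (j + n) = ω * a j) (hc : ∀ j, c (j + n) = c j) (hcpos : ∀ j, 0 < c j)
    (hz : ∀ j, z (j + 1) = z j + c j) (i : ℕ) :
    Summable fun k : ℕ => ((x ^ (z (i + 1 + k) - z i) : ℝ) : ℂ) * a (i + 1 + k) := by
  -- a uniform positive lower bound on the spacings
  obtain ⟨cmin, hcmin, hcle⟩ : ∃ cmin : ℝ, 0 < cmin ∧ ∀ j, cmin ≤ c j := by
    obtain ⟨j₀, -, hmin⟩ :=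
      (Finset.range n).exists_min_image c ⟨0, Finset.mem_range.2 hn⟩
    refine ⟨c j₀, hcpos j₀, fun j => ?_⟩
    induction j using Nat.strong_induction_on with
    | _ j ih =>
      by_cases hj : j < n
      · exact hmin j (Finset.mem_range.2 hj)
      · have h1 : j - n + n = j := Nat.sub_add_cancel (not_lt.1 hj)
        have h2 := ih (j - n) (by omega)
        rw [← h1, hc]
        exact h2
  -- a uniform bound on the amplitudes
  obtain ⟨M, hM⟩ : ∃ M : ℝ, ∀ j, ‖a j‖ ≤ M := by
    refine ⟨∑ j ∈ Finset.range n, ‖a j‖, fun j => ?_⟩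
    induction j using Nat.strong_induction_on with
    | _ j ih =>
      by_cases hj : j < n
      · exact Finset.single_le_sum (f := fun j => ‖a j‖) (fun _ _ => norm_nonneg _)
          (Finset.mem_range.2 hj)
      · have h1 : j - n + n = j := Nat.sub_add_cancel (not_lt.1 hj)
        have h2 := ih (j - n) (by omega)
        rw [← h1, ha, norm_mul, hω, one_mul]
        exact h2
  -- linear growth of the heights
  have hgrow : ∀ k : ℕ, z i + ((k : ℝ) + 1) * cmin ≤ z (i + 1 + k) := by
    intro k
    induction k with
    | zero =>
      rw [Nat.add_zero, hz i, Nat.cast_zero, zero_add, one_mul]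
      linarith [hcle i]
    | succ k ih =>
      rw [show i + 1 + (k + 1) = i + 1 + k + 1 from rfl, hz (i + 1 + k)]
      push_cast
      nlinarith [hcle (i + 1 + k)]
  -- geometric domination
  have hr0 : 0 ≤ x ^ cmin := Real.rpow_nonneg hx.le _
  have hr1 : x ^ cmin < 1 := Real.rpow_lt_one hx.le hx1 hcmin
  refine Summable.of_norm_bounded ((summable_geometric_of_lt_one hr0 hr1).mul_left M) ?_
  intro k
  rw [norm_mul, Complex.norm_of_nonneg (Real.rpow_nonneg hx.le _)]
  have hexp : x ^ (z (i + 1 + k) - z i) ≤ (x ^ cmin) ^ k := by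
    rw [← Real.rpow_natCast, ← Real.rpow_mul hx.le]
    apply Real.rpow_le_rpow_of_exponent_ge hx hx1.le
    have h1 := hgrow k
    have h2 : ((k : ℝ) + 1) * cmin = cmin * k + cmin := by ring
    rw [h2] at h1
    linarith [hcmin.le]
  calc x ^ (z (i + 1 + k) - z i) * ‖a (i + 1 + k)‖ ≤ (x ^ cmin) ^ k * M :=
        mul_le_mul hexp (hM _) (norm_nonneg _) (pow_nonneg hr0 _)
    _ = M * (x ^ cmin) ^ k := mul_comm _ _

/-- **Markov property of the upward field.**  Splitting off the `k = 0` term,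
`U i = x^{cᵢ} (aᵢ₊₁ + Uᵢ₊₁)`, since `x^{z(i+2+k) − z(i)} = x^{cᵢ} x^{z(i+2+k) − z(i+1)}`. -/
theorem sliceIdentity_markov (n : ℕ) (ω : ℂ) (a : ℕ → ℂ) (c z : ℕ → ℝ) (x : ℝ)
    (hn : 0 < n) (hω : ‖ω‖ = 1) (hx : 0 < x) (hx1 : x < 1)
    (ha : ∀ j, a (j + n) = ω * a j) (hc : ∀ j, c (j + n) = c j) (hcpos : ∀ j, 0 < c j)
    (hz : ∀ j, z (j + 1) = z j + c j) (i : ℕ) :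
    ∑' k : ℕ, ((x ^ (z (i + 1 + k) - z i) : ℝ) : ℂ) * a (i + 1 + k)
      = ((x ^ (c i) : ℝ) : ℂ) * (a (i + 1)
          + ∑' k : ℕ, ((x ^ (z (i + 1 + 1 + k) - z (i + 1)) : ℝ) : ℂ) * a (i + 1 + 1 + k)) := by
  have hs := sliceIdentity_summable n ω a c z x hn hω hx hx1 ha hc hcpos hz i
  rw [hs.tsum_eq_zero_add]
  have h0 : ((x ^ (z (i + 1 + 0) - z i) : ℝ) : ℂ) * a (i + 1 + 0)
      = ((x ^ (c i) : ℝ) : ℂ) * a (i + 1) := by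
    rw [Nat.add_zero, hz i, add_sub_cancel_left]
  have h1 : ∀ k : ℕ, ((x ^ (z (i + 1 + (k + 1)) - z i) : ℝ) : ℂ) * a (i + 1 + (k + 1))
      = ((x ^ (c i) : ℝ) : ℂ)
        * (((x ^ (z (i + 1 + 1 + k) - z (i + 1)) : ℝ) : ℂ) * a (i + 1 + 1 + k)) := by
    intro k
    have hk : i + 1 + (k + 1) = i + 1 + 1 + k := by omega
    have he : z (i + 1 + 1 + k) - z i = c i + (z (i + 1 + 1 + k) - z (i + 1)) := by
      rw [hz i]
      ring
    rw [hk, he, Real.rpow_add hx, Complex.ofReal_mul, mul_assoc]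
  rw [h0, tsum_congr h1, tsum_mul_left, mul_add]

/-- **Quasi-periodicity of the upward field.**  `z (j + n) = z j + (z n − z 0)` and
`a (j + n) = ω a j` give `U n = ω U 0`, hence `‖U n‖ = ‖U 0‖` as `‖ω‖ = 1`. -/
theorem sliceIdentity_norm_period (n : ℕ) (ω : ℂ) (a : ℕ → ℂ) (c z : ℕ → ℝ) (x : ℝ)
    (hω : ‖ω‖ = 1) (ha : ∀ j, a (j + n) = ω * a j) (hc : ∀ j, c (j + n) = c j)
    (hz : ∀ j, z (j + 1) = z j + c j) :
    ‖∑' k : ℕ, ((x ^ (z (n + 1 + k) - z n) : ℝ) : ℂ) * a (n + 1 + k)‖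
      = ‖∑' k : ℕ, ((x ^ (z (0 + 1 + k) - z 0) : ℝ) : ℂ) * a (0 + 1 + k)‖ := by
  have hper : ∀ j, z (j + n) = z j + (z n - z 0) := by
    intro j
    induction j with
    | zero => rw [Nat.zero_add]; ring
    | succ j ih =>
      rw [show j + 1 + n = j + n + 1 by omega, hz (j + n), hz j, ih, hc j]
      ring
  have hterm : ∀ k : ℕ, ((x ^ (z (n + 1 + k) - z n) : ℝ) : ℂ) * a (n + 1 + k)
      = ω * (((x ^ (z (0 + 1 + k) - z 0) : ℝ) : ℂ) * a (0 + 1 + k)) := by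
    intro k
    have h1 : n + 1 + k = 0 + 1 + k + n := by omega
    have h2 : z (0 + 1 + k) + (z n - z 0) - z n = z (0 + 1 + k) - z 0 := by ring
    rw [h1, hper, ha, h2]
    ring
  rw [tsum_congr hterm, tsum_mul_left, norm_mul, hω, one_mul]

/-- **Stub 5 — the exponential-slice mismatch identity (sum of squares).**  For one planar mode
and one exponential slice `x^{|Δz|}` (`0 < x < 1`) of the cross-plane kernel, with layer
amplitudes `a j` quasi-periodic of period `n` and unimodular twist `ω`, spacings `c j > 0` of
period `n` and heights `z (j + 1) = z j + c j`, the chessboard deficit over one period equals the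
sum over `i < n` of `|(1 − x^{2cᵢ}) Uᵢ₊₁ − x^{cᵢ} aᵢ − x^{2cᵢ} aᵢ₊₁|² / (1 − x^{2cᵢ})`, where
`Uᵢ = ∑_k x^{z(i+1+k) − z(i)} a (i+1+k)` is the upward field.  Markov property + telescoping +
`‖U n‖ = ‖U 0‖`. [folklore; cf. Giuliani–Lebowitz–Lieb 2006 §3] -/
theorem stub_sliceIdentity :
    ∀ (n : ℕ) (ω : ℂ) (a : ℕ → ℂ) (c z : ℕ → ℝ) (x : ℝ), 0 < n → ‖ω‖ = 1 → 0 < x → x < 1 →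
      (∀ j, a (j + n) = ω * a j) → (∀ j, c (j + n) = c j) → (∀ j, 0 < c j) →
      (∀ j, z (j + 1) = z j + c j) →
      ∑ i ∈ Finset.range n,
          ((2 * (a i * starRingEnd ℂ (a (i + 1))).re * x ^ (c i)
              + (‖a i‖ ^ 2 + ‖a (i + 1)‖ ^ 2) * x ^ (2 * c i)) / (1 - x ^ (2 * c i))
            - 2 * (a i * starRingEnd ℂ
                (∑' k : ℕ, ((x ^ (z (i + 1 + k) - z i) : ℝ) : ℂ) * a (i + 1 + k))).re)
        = ∑ i ∈ Finset.range n,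
          ‖((1 - x ^ (2 * c i) : ℝ) : ℂ) *
                (∑' k : ℕ, ((x ^ (z (i + 2 + k) - z (i + 1)) : ℝ) : ℂ) * a (i + 2 + k))
              - ((x ^ (c i) : ℝ) : ℂ) * a i - ((x ^ (2 * c i) : ℝ) : ℂ) * a (i + 1)‖ ^ 2
            / (1 - x ^ (2 * c i)) := by
  intro n ω a c z x hn hω hx hx1 ha hc hcpos hz
  exact sliceIdentity_core n a c x
    (fun i => ∑' k : ℕ, ((x ^ (z (i + 1 + k) - z i) : ℝ) : ℂ) * a (i + 1 + k)) hx hx1 hcpos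
    (sliceIdentity_markov n ω a c z x hn hω hx hx1 ha hc hcpos hz)
    (sliceIdentity_norm_period n ω a c z x hω ha hc hz)

end Summit.AtomisticToContinuum.Crystallization.Theorems.ChessboardParticlePlanesLjPlaneChessboard

end
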